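import Summits.NavierStokesRegularity.NavierStokesRegularity.Theorems.LerayQuarterDissipationFiniteDissipationLiouvilleSubthreshold
import HarnessLib

/-!
# Crux `FiniteDissipationLiouville` (stmt-NavierStokesRegularity-22144): the sub-threshold leaf in
# its two LIMIT forms — far past and apex

Theorems file of route `LerayQuarterDissipation` (seat ns-lqd-p1 g2; `--supports` the crux and its
child stmt-22508). Navier–Stokes regularity is NOT proved by anything here; no summit is.

Corollaries of `…Subthreshold.notSingular_of_subthreshold_windows` (p589634): with `K₀ > 0` the
absolute gap constant and `D_u(t) = √(−t) ∫ ‖∇u(t)‖²` the dimensionless dissipation of a member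
`u` of the stratum (Type-I ancient mild in the KNSS gauge, quarter-rate dissipation law),

* `notSingular_of_subthreshold_farPast` — if `D_u ≤ K₁ ≤ K₀` on a whole far-past half-line
  `t ≤ T` (`T < 0`), then `u` is bounded at the apex (windows `[Λ⁴T, T]`);
* `notSingular_of_subthreshold_nearApex` — if `D_u ≤ K₁ ≤ K₀` on a whole terminal segment
  `T ≤ t < 0`, then `u` is bounded at the apex (windows `[T, T/Λ⁴]`);
* contrapositives `exists_farPast_dissipation_gt_of_singular`,
  `exists_nearApex_dissipation_gt_of_singular` — a SINGULAR member has `D_u(t) > K₁` at times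
  `t ≤ T` for every `T < 0` AND at times `t ∈ [T, 0)` for every `T < 0`: in words,
  `limsup_{t → −∞} D_u ≥ K₀` and `limsup_{t → 0⁻} D_u ≥ K₀` for every singular finite-dissipation
  Type-I profile. The far-past statement ties the behaviour at `t → −∞` to regularity at the apex
  (zoom-OUT limits + persistence of the apex singularity along the scaling orbit).
-/

noncomputable section

-- the summit and its single sub-problem share the name (CONVENTIONS §1), as in every Theorems file
set_option linter.dupNamespace false

namespace Summit.NavierStokesRegularity.NavierStokesRegularity.Theorems.FiniteDissipationLiouville.Subthreshold

open MeasureTheory Set Filter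
open Literature.Analysis Literature.Analysis.FluidPDE
open scoped ENNReal

/-- **Far-past sub-threshold dissipation forces apex regularity.** There is an absolute `K₀ > 0`
such that a member of the stratum (any `C`, `K`) with `√(−t) ∫ ‖∇u(t)‖² ≤ K₁ ≤ K₀` for all
`t ≤ T` (some `T < 0`) is bounded on some backward cylinder at the origin. -/
theorem notSingular_of_subthreshold_farPast :
    ∃ K₀ : ℝ, 0 < K₀ ∧ ∀ (C K K₁ : ℝ)
      (u : ℝ → EuclideanSpace ℝ (Fin 3) → EuclideanSpace ℝ (Fin 3)), K₁ ≤ K₀ →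
      IsTypeIAncientMild C u →
      (∀ s : ℝ, s < 0 → ∫⁻ x, ‖fderiv ℝ (u s) x‖ₑ ^ 2 ≤ ENNReal.ofReal (K / Real.sqrt (-s))) →
      (∃ T : ℝ, T < 0 ∧ ∀ t : ℝ, t ≤ T →
        ∫⁻ x, ‖fderiv ℝ (u t) x‖ₑ ^ 2 ≤ ENNReal.ofReal (K₁ / Real.sqrt (-t))) →
      ¬ (∀ r > 0, ∀ M : ℝ, ∃ t ∈ Set.Ioo (-(r ^ 2)) (0 : ℝ),
          ∃ x ∈ Metric.ball (0 : EuclideanSpace ℝ (Fin 3)) r, M < ‖u t x‖) := by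
  obtain ⟨K₀, hK₀, h⟩ := notSingular_of_subthreshold_windows
  refine ⟨K₀, hK₀, fun C K K₁ u hK₁ hu hlaw ⟨T, hT, hfar⟩ => h C K K₁ u hK₁ hu hlaw fun Λ hΛ => ?_⟩
  -- the window `[Λ²τ, τ/Λ²]` with `τ = Λ² T` lies in `t ≤ T`
  have hΛ2 : 1 < Λ ^ 2 := by nlinarith
  refine ⟨Λ ^ 2 * T, by nlinarith, fun t ht => hfar t ?_⟩
  have h1 : t ≤ Λ ^ 2 * T / Λ ^ 2 := ht.2
  rwa [mul_div_cancel_left₀ _ (by positivity : Λ ^ 2 ≠ 0)] at h1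

/-- **Near-apex sub-threshold dissipation forces apex regularity.** There is an absolute `K₀ > 0`
such that a member of the stratum (any `C`, `K`) with `√(−t) ∫ ‖∇u(t)‖² ≤ K₁ ≤ K₀` for all
`t ∈ [T, 0)` (some `T < 0`) is bounded on some backward cylinder at the origin. -/
theorem notSingular_of_subthreshold_nearApex :
    ∃ K₀ : ℝ, 0 < K₀ ∧ ∀ (C K K₁ : ℝ)
      (u : ℝ → EuclideanSpace ℝ (Fin 3) → EuclideanSpace ℝ (Fin 3)), K₁ ≤ K₀ →
      IsTypeIAncientMild C u →
      (∀ s : ℝ, s < 0 → ∫⁻ x, ‖fderiv ℝ (u s) x‖ₑ ^ 2 ≤ ENNReal.ofReal (K / Real.sqrt (-s))) →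
      (∃ T : ℝ, T < 0 ∧ ∀ t : ℝ, T ≤ t → t < 0 →
        ∫⁻ x, ‖fderiv ℝ (u t) x‖ₑ ^ 2 ≤ ENNReal.ofReal (K₁ / Real.sqrt (-t))) →
      ¬ (∀ r > 0, ∀ M : ℝ, ∃ t ∈ Set.Ioo (-(r ^ 2)) (0 : ℝ),
          ∃ x ∈ Metric.ball (0 : EuclideanSpace ℝ (Fin 3)) r, M < ‖u t x‖) := by
  obtain ⟨K₀, hK₀, h⟩ := notSingular_of_subthreshold_windows
  refine ⟨K₀, hK₀, fun C K K₁ u hK₁ hu hlaw ⟨T, hT, hnear⟩ => h C K K₁ u hK₁ hu hlaw fun Λ hΛ => ?_⟩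
  -- the window `[Λ²τ, τ/Λ²]` with `τ = T/Λ²` lies in `[T, 0)`
  have hΛ2 : (0 : ℝ) < Λ ^ 2 := by positivity
  refine ⟨T / Λ ^ 2, div_neg_of_neg_of_pos hT hΛ2, fun t ht => hnear t ?_ ?_⟩
  · have h1 : Λ ^ 2 * (T / Λ ^ 2) ≤ t := ht.1
    rwa [mul_div_cancel₀ _ hΛ2.ne'] at h1
  · have h2 : t ≤ T / Λ ^ 2 / Λ ^ 2 := ht.2
    have h3 : T / Λ ^ 2 / Λ ^ 2 < 0 := div_neg_of_neg_of_pos (div_neg_of_neg_of_pos hT hΛ2) hΛ2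
    linarith

/-- **A singular profile's dissipation exceeds the gap constant arbitrarily far in the past**
(`limsup_{t→−∞} √(−t)∫‖∇u(t)‖² ≥ K₀`): for every singular member of the stratum, every `K₁ ≤ K₀`
and every `T < 0` there is `t ≤ T` with `K₁/√(−t) < ∫ ‖∇u(t)‖²`. -/
theorem exists_farPast_dissipation_gt_of_singular :
    ∃ K₀ : ℝ, 0 < K₀ ∧ ∀ (C K K₁ : ℝ)
      (u : ℝ → EuclideanSpace ℝ (Fin 3) → EuclideanSpace ℝ (Fin 3)), K₁ ≤ K₀ →
      IsTypeIAncientMild C u →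
      (∀ s : ℝ, s < 0 → ∫⁻ x, ‖fderiv ℝ (u s) x‖ₑ ^ 2 ≤ ENNReal.ofReal (K / Real.sqrt (-s))) →
      (∀ r > 0, ∀ M : ℝ, ∃ t ∈ Set.Ioo (-(r ^ 2)) (0 : ℝ),
          ∃ x ∈ Metric.ball (0 : EuclideanSpace ℝ (Fin 3)) r, M < ‖u t x‖) →
      ∀ T : ℝ, T < 0 → ∃ t : ℝ, t ≤ T ∧
        ENNReal.ofReal (K₁ / Real.sqrt (-t)) < ∫⁻ x, ‖fderiv ℝ (u t) x‖ₑ ^ 2 := by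
  obtain ⟨K₀, hK₀, h⟩ := notSingular_of_subthreshold_farPast
  refine ⟨K₀, hK₀, fun C K K₁ u hK₁ hu hlaw hsing T hT => ?_⟩
  by_contra hcon
  push Not at hcon
  exact h C K K₁ u hK₁ hu hlaw ⟨T, hT, hcon⟩ hsing

/-- **A singular profile's dissipation exceeds the gap constant arbitrarily close to the apex**
(`limsup_{t→0⁻} √(−t)∫‖∇u(t)‖² ≥ K₀`): for every singular member of the stratum, every `K₁ ≤ K₀`
and every `T < 0` there is `t ∈ [T, 0)` with `K₁/√(−t) < ∫ ‖∇u(t)‖²`. -/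
theorem exists_nearApex_dissipation_gt_of_singular :
    ∃ K₀ : ℝ, 0 < K₀ ∧ ∀ (C K K₁ : ℝ)
      (u : ℝ → EuclideanSpace ℝ (Fin 3) → EuclideanSpace ℝ (Fin 3)), K₁ ≤ K₀ →
      IsTypeIAncientMild C u →
      (∀ s : ℝ, s < 0 → ∫⁻ x, ‖fderiv ℝ (u s) x‖ₑ ^ 2 ≤ ENNReal.ofReal (K / Real.sqrt (-s))) →
      (∀ r > 0, ∀ M : ℝ, ∃ t ∈ Set.Ioo (-(r ^ 2)) (0 : ℝ),
          ∃ x ∈ Metric.ball (0 : EuclideanSpace ℝ (Fin 3)) r, M < ‖u t x‖) →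
      ∀ T : ℝ, T < 0 → ∃ t : ℝ, T ≤ t ∧ t < 0 ∧
        ENNReal.ofReal (K₁ / Real.sqrt (-t)) < ∫⁻ x, ‖fderiv ℝ (u t) x‖ₑ ^ 2 := by
  obtain ⟨K₀, hK₀, h⟩ := notSingular_of_subthreshold_nearApex
  refine ⟨K₀, hK₀, fun C K K₁ u hK₁ hu hlaw hsing T hT => ?_⟩
  by_contra hcon
  push Not at hcon
  exact h C K K₁ u hK₁ hu hlaw ⟨T, hT, fun t h1 h2 => hcon t h1 h2⟩ hsing

end Summit.NavierStokesRegularity.NavierStokesRegularity.Theorems.FiniteDissipationLiouville.Subthreshold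

end
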